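import Summits.ValiantsHypothesis.ValiantsHypothesis.Theorems.LacunarySymmetroidMatrixDescartesPivotRankOneCriticalWindowsOneSidedSeven
import Summits.ValiantsHypothesis.ValiantsHypothesis.Theorems.LacunarySymmetroidMatrixDescartesPivotRankOneReductionOneThree

/-!
# `MatrixDescartes` census — rank-one `(2,4)₁`, the `1|3` split: THE SEVEN OBJECT HAS EXACTLY SEVEN POSITIVE ROOTS
# (the certificate of `…CriticalWindowsOneSidedSeven` meets the Descartes-with-parity bound of `…PivotRankOneReductionOneThree` off chamber (C))

HONEST FRAMING.  Object-search cell `pub-symmetroid`, seat `val-sym-mdr-p1` (generation 25); helper file `--supports` the crux item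
stmt-ValiantsHypothesis-18050 (`Theses.LacunarySymmetroid.MatrixDescartes`, OPEN, on HOLD) with NO closure claim.  Two-line bookkeeping: the
all-core one-sided `K = 4` object of `…OneSidedSeven` (`e = 1`, `d = (0, 8, 53, 248)`, `w = (2, 19/2, 42, 212)`, `t = (1/16384, 1, 1, 1 + 2⁻²¹)`)
lies OUTSIDE chamber (C) (`d₀ + d₁ = 8 > 2 = 2e`), so `…PivotRankOneReductionOneThree.rankOne_posRoots_le_seven_of_not_chamberC` (the
lineage's Descartes-with-parity count, g13) caps it at `7`; with `seven_le_sevenObject_pivotPosRoots` it has **EXACTLY SEVEN** positive roots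
(`sevenObject_pivotPosRoots_eq_seven`) — the Descartes bound of its chamber is ATTAINED by an all-core rank-one pencil.  Nothing here bears on
`MatrixDescartes` in its window, on `DoorA26` / `DoorA34`, the rank-one register `{8, 9}`, ζ, or `VP ≠ VNP`.

[folklore] Repackaging of the pencil (`Matrix.map_smul`-type bookkeeping); tree theorems named above.  No definitions, no named facts.
-/

-- `Summit.ValiantsHypothesis.ValiantsHypothesis.…` repeats a component by the D-0017 layout
-- (single-conjunct summit), which the `dupNamespace` linter flags; the name is mandated.
set_option linter.dupNamespace false

namespace Summit.ValiantsHypothesis.ValiantsHypothesis.Theorems.LacunarySymmetroidMatrixDescartes.Pivot.CriticalWindows.OneSidedSeven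

open Polynomial Finset Matrix
open scoped BigOperators
open Summit.ValiantsHypothesis.ValiantsHypothesis.Theorems.LacunarySymmetroidMatrixDescartes.Pivot (pivotPosRoots)
open Summit.ValiantsHypothesis.ValiantsHypothesis.Theorems.LacunarySymmetroidMatrixDescartes.Pivot.RankOneReduction
  (rankOne_posRoots_le_seven_of_not_chamberC)

/-- The pencil of `pivotPosRoots` with letters `wₖ·vₖvₖᵀ` (`Fin 4`), unrolled into the four-letter form of `…PivotRankOneReduction*`
(`(C wₖ · X^{dₖ}) • (vₖvₖᵀ).map C`). [bookkeeping] -/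
theorem pencil_four_unroll (e : ℕ) (d : Fin 4 → ℕ) (J : Matrix (Fin 2) (Fin 2) ℝ) (w : Fin 4 → ℝ) (v : Fin 4 → Fin 2 → ℝ) :
    ((X : ℝ[X]) ^ e) • J.map Polynomial.C + ∑ k, ((X : ℝ[X]) ^ d k) • (w k • vecMulVec (v k) (v k)).map Polynomial.C
      = ((X : ℝ[X]) ^ e) • J.map Polynomial.C
        + (Polynomial.C (w 0) * X ^ d 0) • (vecMulVec (v 0) (v 0)).map Polynomial.C
        + (Polynomial.C (w 1) * X ^ d 1) • (vecMulVec (v 1) (v 1)).map Polynomial.C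
        + (Polynomial.C (w 2) * X ^ d 2) • (vecMulVec (v 2) (v 2)).map Polynomial.C
        + (Polynomial.C (w 3) * X ^ d 3) • (vecMulVec (v 3) (v 3)).map Polynomial.C := by
  have hk : ∀ k : Fin 4, ((X : ℝ[X]) ^ d k) • (w k • vecMulVec (v k) (v k)).map Polynomial.C
      = (Polynomial.C (w k) * X ^ d k) • (vecMulVec (v k) (v k)).map Polynomial.C := by
    intro k
    ext i j
    simp only [Matrix.smul_apply, Matrix.map_apply, vecMulVec_apply, smul_eq_mul, Polynomial.C_mul]
    ring
  simp only [hk, Fin.sum_univ_four]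
  abel

/-- **AT MOST SEVEN** for the seven object: it lies outside chamber (C) (`d₀ + d₁ = 8 > 2e = 2`), and its below-pivot letter is core
(`m(J, v₀) = −2·(1/16384) < 0`). [this file + `rankOne_posRoots_le_seven_of_not_chamberC`] -/
theorem sevenObject_pivotPosRoots_le_seven :
    pivotPosRoots 1 (![0, 8, 53, 248] : Fin 4 → ℕ) ((!![(0 : ℝ), 1; 1, 0] : Matrix (Fin 2) (Fin 2) ℝ))
      (fun k => (![(2 : ℝ), 19 / 2, 42, 212] : Fin 4 → ℝ) k
        • vecMulVec ![1, (![(1 : ℝ) / 16384, 1, 1, 1 + 1 / 2097152] : Fin 4 → ℝ) k]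
          ![1, (![(1 : ℝ) / 16384, 1, 1, 1 + 1 / 2097152] : Fin 4 → ℝ) k]) ≤ 7 := by
  unfold pivotPosRoots
  rw [pencil_four_unroll]
  have h := rankOne_posRoots_le_seven_of_not_chamberC 1 0 8 53 248 (by norm_num) (by norm_num) (by norm_num) (by norm_num)
    (by norm_num) (!![(0 : ℝ), 1; 1, 0]) ![1, 1 / 16384] ![1, 1] ![1, 1] ![1, 1 + 1 / 2097152] 2 (19 / 2) 42 212
    (by norm_num) (by norm_num) (by norm_num) (by norm_num) (by simp)
  simpa using h

/-- **THE SEVEN OBJECT HAS EXACTLY SEVEN POSITIVE ROOTS.** [this file] -/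
theorem sevenObject_pivotPosRoots_eq_seven :
    pivotPosRoots 1 (![0, 8, 53, 248] : Fin 4 → ℕ) ((!![(0 : ℝ), 1; 1, 0] : Matrix (Fin 2) (Fin 2) ℝ))
      (fun k => (![(2 : ℝ), 19 / 2, 42, 212] : Fin 4 → ℝ) k
        • vecMulVec ![1, (![(1 : ℝ) / 16384, 1, 1, 1 + 1 / 2097152] : Fin 4 → ℝ) k]
          ![1, (![(1 : ℝ) / 16384, 1, 1, 1 + 1 / 2097152] : Fin 4 → ℝ) k]) = 7 :=
  le_antisymm sevenObject_pivotPosRoots_le_seven seven_le_sevenObject_pivotPosRoots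

end Summit.ValiantsHypothesis.ValiantsHypothesis.Theorems.LacunarySymmetroidMatrixDescartes.Pivot.CriticalWindows.OneSidedSeven
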